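import Summits.KontsevichZagierPeriods.KontsevichZagierPeriods.Theses.OctahedralSymmetry
import Summits.KontsevichZagierPeriods.KontsevichZagierPeriods.Theorems.FurushoPentagonHoffmanRelationInKZCubicalTransportAux2

/-!
# `LevelFourStuffleInKZ` (stmt-KontsevichZagierPeriods-9434, route `OctahedralSymmetry`), line `Sketch`:
# stub `stub_transportSpectator` — the spectator chart of the product domain

One KZ change-of-variables move (rule 2): a 3-dimensional integral representation `P` on the literal
product domain `(0,1) × Δ₂ = {t | 0 < t₀ < 1, 1 > t₁ > t₂ > 0}` of the crux `LevelFourStuffleInKZ` is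
KZ-equivalent to its pull-back `Pt` on the open cube `(0,1)³` along the *spectator* monomial chart
`Ψ(s) = (s₀, s₁, s₁s₂)` (rows `{0}, {1}, {1,2}`, lower-triangular, Jacobian `s₁ > 0`); `Pt` exists
because absolute integrability is transported along the chart (`monomialChart_transport`, landed in
`FurushoPentagonHoffmanRelationInKZCubicalTransportAux.lean`). What is proved here by hand is the
calculus of this particular chart: injectivity on the cube and image EXACTLY the typed product domain
(inverse `s = (t₀, t₁, t₂/t₁)`); the semialgebraicity of the cube (finite intersection of strict
polynomial inequalities) is re-derived inline.

References: M. Kontsevich, D. Zagier, *Periods* (2001), §1.2 rule (2).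
-/

noncomputable section

open Set MeasureTheory
open Literature.NumberTheory.Transcendental
open Literature.NumberTheory.Transcendental.KZ
open Summit.KontsevichZagierPeriods.FurushoPentagon.HoffmanRelationInKZ (monomialChart_transport)

namespace Summit.KontsevichZagierPeriods.OctahedralSymmetry.LevelFourStuffleInKZ

/-- The spectator chart in monomial normal form is `s ↦ (s₀, s₁, s₁s₂)`. [folklore] -/
theorem spectatorChart_eq (s : Fin 3 → ℝ) :
    (fun i => ∏ j ∈ (![{0}, {1}, {1, 2}] : Fin 3 → Finset (Fin 3)) i, s j) = ![s 0, s 1, s 1 * s 2] := by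
  funext i
  fin_cases i
  · simp
  · simp
  · simp only [Fin.reduceFinMk, Matrix.cons_val_two, Matrix.tail_cons, Matrix.head_cons]
    rw [Finset.prod_pair (by decide)]

/-- The rows of the spectator chart are supported on `j ≤ i` and contain the diagonal. [folklore] -/
theorem spectatorRows_le :
    (∀ i, ∀ j ∈ (![{0}, {1}, {1, 2}] : Fin 3 → Finset (Fin 3)) i, j ≤ i) ∧
      (∀ i, i ∈ (![{0}, {1}, {1, 2}] : Fin 3 → Finset (Fin 3)) i) := by
  refine ⟨fun i => ?_, fun i => ?_⟩
  · fin_cases i <;> simp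
  · fin_cases i <;> simp

/-- The Jacobian of the spectator chart: `∏ᵢ ∏_{k ∈ Sᵢ, k ≠ i} s_k = s₁`. [folklore] -/
theorem spectatorJacobian_eq (s : Fin 3 → ℝ) :
    ∏ i, ∏ k ∈ ((![{0}, {1}, {1, 2}] : Fin 3 → Finset (Fin 3)) i).erase i, s k = s 1 := by
  rw [Fin.prod_univ_three]
  have h0 : ((![{0}, {1}, {1, 2}] : Fin 3 → Finset (Fin 3)) 0).erase 0 = ∅ := by decide
  have h1 : ((![{0}, {1}, {1, 2}] : Fin 3 → Finset (Fin 3)) 1).erase 1 = ∅ := by decide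
  have h2 : ((![{0}, {1}, {1, 2}] : Fin 3 → Finset (Fin 3)) 2).erase 2 = {1} := by decide
  rw [h0, h1, h2]
  simp

/-- The spectator chart is injective on the open cube (`s₂ = t₂ / t₁`). [folklore] -/
theorem injOn_spectatorChart :
    Set.InjOn (fun (s : Fin 3 → ℝ) (i : Fin 3) => ∏ j ∈ (![{0}, {1}, {1, 2}] : Fin 3 → Finset (Fin 3)) i, s j)
      {x : Fin 3 → ℝ | ∀ i, x i ∈ Set.Ioo (0:ℝ) 1} := by
  intro x hx y _ hxy
  have hxy' : (![x 0, x 1, x 1 * x 2] : Fin 3 → ℝ) = ![y 0, y 1, y 1 * y 2] := by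
    rw [← spectatorChart_eq x, ← spectatorChart_eq y]; exact hxy
  have e0 : x 0 = y 0 := by simpa using congr_fun hxy' 0
  have e1 : x 1 = y 1 := by simpa using congr_fun hxy' 1
  have e2 : x 1 * x 2 = y 1 * y 2 := by simpa using congr_fun hxy' 2
  have hx1 : x 1 ≠ 0 := (hx 1).1.ne'
  have e2' : x 2 = y 2 := by
    rw [← e1] at e2
    exact mul_left_cancel₀ hx1 e2
  funext i
  fin_cases i
  · exact e0
  · exact e1
  · exact e2'

/-- The spectator chart maps the open cube ONTO the typed product domain `(0,1) × Δ₂`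
(inverse `s = (t₀, t₁, t₂/t₁)`). [folklore] -/
theorem image_spectatorChart :
    (fun (s : Fin 3 → ℝ) (i : Fin 3) => ∏ j ∈ (![{0}, {1}, {1, 2}] : Fin 3 → Finset (Fin 3)) i, s j) ''
        {x : Fin 3 → ℝ | ∀ i, x i ∈ Set.Ioo (0:ℝ) 1} =
      {t : Fin 3 → ℝ | (0 < t 0 ∧ t 0 < 1) ∧ 1 > t 1 ∧ t 1 > t 2 ∧ t 2 > 0} := by
  ext t
  simp only [Set.mem_image, Set.mem_setOf_eq, spectatorChart_eq]
  constructor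
  · rintro ⟨x, hx, rfl⟩
    have h0 := hx 0; have h1 := hx 1; have h2 := hx 2
    simp only [Set.mem_Ioo] at h0 h1 h2
    simp only [Matrix.cons_val_zero, Matrix.cons_val_one, Matrix.cons_val_two, Matrix.tail_cons,
      Matrix.head_cons]
    refine ⟨h0, h1.2, ?_, mul_pos h1.1 h2.1⟩
    nlinarith [mul_pos h1.1 (sub_pos.mpr h2.2)]
  · rintro ⟨⟨h0, h0'⟩, h1, h12, h2⟩
    have ht1 : 0 < t 1 := h2.trans h12
    refine ⟨![t 0, t 1, t 2 / t 1], ?_, ?_⟩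
    · intro i
      fin_cases i
      · exact ⟨h0, h0'⟩
      · exact ⟨ht1, h1⟩
      · exact ⟨div_pos h2 ht1, (div_lt_one ht1).mpr h12⟩
    · funext i
      fin_cases i
      · simp
      · simp
      · simp only [Fin.reduceFinMk, Matrix.cons_val, Matrix.cons_val_one, Matrix.cons_val_zero]
        exact mul_div_cancel₀ _ ht1.ne'

/-- **Stub `stub_transportSpectator`** (rule 2, one move): every representation on the literal product
domain `(0,1) × Δ₂` has a pull-back to the open cube along the spectator chart `s ↦ (s₀, s₁, s₁s₂)`
(Jacobian `s₁`), KZ-equivalent to it; existence of the pull-back (transported integrability) and the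
move are `monomialChart_transport`. [cite: KontsevichZagier2001, §1.2 rule (2)] -/
theorem stub_transportSpectator (P : IntegralRep 3)
    (hP : P.domain = {t | (0 < t 0 ∧ t 0 < 1) ∧ 1 > t 1 ∧ t 1 > t 2 ∧ t 2 > 0}) :
    ∃ Pt : IntegralRep 3, Pt.domain = {s | ∀ i, s i ∈ Set.Ioo (0:ℝ) 1} ∧
      (∀ s ∈ {s : Fin 3 → ℝ | ∀ i, s i ∈ Set.Ioo (0:ℝ) 1},
        Pt.integrand s = P.integrand ![s 0, s 1, s 1 * s 2] * s 1) ∧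
      of Pt - of P ∈ relations := by
  obtain ⟨hS, hS'⟩ := spectatorRows_le
  -- the open cube is `ℚ`-semialgebraic: `⋂ᵢ {0 < xᵢ} ∩ {0 < 1 − xᵢ}`
  have hD : Literature.ModelTheory.ExponentialFields.IsSemialgebraic ℚ
      {x : Fin 3 → ℝ | ∀ i, x i ∈ Set.Ioo (0:ℝ) 1} := by
    have : {x : Fin 3 → ℝ | ∀ i, x i ∈ Set.Ioo (0:ℝ) 1} = ⋂ i ∈ (Finset.univ : Finset (Fin 3)),
        ({x : Fin 3 → ℝ | 0 < MvPolynomial.aeval x (MvPolynomial.X i : MvPolynomial (Fin 3) ℚ)} ∩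
          {x | 0 < MvPolynomial.aeval x (1 - MvPolynomial.X i : MvPolynomial (Fin 3) ℚ)}) := by
      ext x
      simp [Set.mem_Ioo, sub_pos]
    rw [this]
    exact Literature.ModelTheory.ExponentialFields.IsSemialgebraic.biInter _ _ fun i _ =>
      (Literature.ModelTheory.ExponentialFields.isSemialgebraic_setOf_eval_pos (k := ℚ) _).inter
        (Literature.ModelTheory.ExponentialFields.isSemialgebraic_setOf_eval_pos (k := ℚ) _)
  have hgh : ∀ y ∈ {x : Fin 3 → ℝ | ∀ i, x i ∈ Set.Ioo (0:ℝ) 1},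
      (fun s : Fin 3 → ℝ => P.integrand ![s 0, s 1, s 1 * s 2] * s 1) y =
        P.integrand ((fun (s : Fin 3 → ℝ) (i : Fin 3) => ∏ j ∈ (![{0}, {1}, {1, 2}] : Fin 3 → Finset (Fin 3)) i, s j) y) *
          |∏ i, ∏ k ∈ ((![{0}, {1}, {1, 2}] : Fin 3 → Finset (Fin 3)) i).erase i, y k| := by
    intro y hy
    have hy1 : 0 < y 1 := (hy 1).1
    simp only [spectatorChart_eq, spectatorJacobian_eq, abs_of_pos hy1]
  obtain ⟨hex, heq⟩ := monomialChart_transport (![{0}, {1}, {1, 2}] : Fin 3 → Finset (Fin 3)) hS hS' hD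
    (fun (s : Fin 3 → ℝ) (i : Fin 3) => ∏ j ∈ (![{0}, {1}, {1, 2}] : Fin 3 → Finset (Fin 3)) i, s j) (fun _ _ => rfl)
    injOn_spectatorChart (fun s : Fin 3 → ℝ => P.integrand ![s 0, s 1, s 1 * s 2] * s 1)
    P.integrand hgh
  have hPd : P.domain = (fun (s : Fin 3 → ℝ) (i : Fin 3) => ∏ j ∈ (![{0}, {1}, {1, 2}] : Fin 3 → Finset (Fin 3)) i, s j) ''
      {x : Fin 3 → ℝ | ∀ i, x i ∈ Set.Ioo (0:ℝ) 1} := by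
    rw [hP, image_spectatorChart]
  obtain ⟨Pt, hPtd, hPti⟩ := hex P hPd (fun _ _ => rfl)
  refine ⟨Pt, hPtd, fun s _ => by rw [hPti], ?_⟩
  exact heq Pt P hPtd (fun s _ => by rw [hPti]) hPd (fun _ _ => rfl)

end Summit.KontsevichZagierPeriods.OctahedralSymmetry.LevelFourStuffleInKZ
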